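import Literature.NumberTheory.Transcendental.GammaFields
import Literature.NumberTheory.Transcendental.GammaFieldsEcl
import Literature.NumberTheory.Transcendental.PseudoExpVariants
import Literature.FieldTheory.AlgClosed.RationalPowers
import Mathlib.RingTheory.RootsOfUnity.PrimitiveRoots
import Mathlib.Algebra.Group.AddChar
import HarnessLib

/-!
# The countable model over a partial exponential field, I: stages of the construction

M. Bays, J. Kirby, *Pseudo-exponential maps, variants, and quasiminimality*, Algebra & Number
Theory 12 (2018), Thm 5.9 / Notation 5.10 (the countable model `M(F_base)` as a limit of finitely
generated strong extensions of the base), with §9.2 (bases which are finitely generated partial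
exponential fields with standard kernel). The printed construction is a Fraïssé limit; we build
the model instead inside a fixed algebraically closed field `Ω` of characteristic zero (which will
carry the model itself) as the union of an `ω`-chain of *stages*. This file sets up the stages:

* `BKModel.EHom Ω := AddChar Ω Ω` — homomorphisms `(Ω, +) → (Ω, ·)` (total extensions of the
  partial exponential maps; only their values on the current domain matter), with the
  exponential-ring structure `EHom.inst` they define, through which the Γ-field algebra of
  `GammaFields.lean` (predimension, strong subspaces) applies at every stage;
* `BKModel.StrongIn E A B` — the predimension clause of `A ◁ B` (Def. 4.3; the kernel clause is
  carried by the stages), its invariance under changing `E` off `B` and its transitivity;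
* `BKModel.State ι hK` — a stage: a `ℚ`-subspace `Λ ≥ ι(D)` finitely generated over the base with a
  homomorphism `E` extending `ι ∘ θ` on `ι(D)` whose kernel on `Λ` is exactly `ι(τ)ℤ`
  (kernel-preserving strong extensions of the base, §3, §9.2);
* `BKModel.Step σ σ'` — `σ'` extends `σ` strongly;
* the three elementary steps: adjoining a logarithm (`exists_step_log`), an exponential
  (`exists_step_exp`) and a generic point of `G¹` (`exists_step_generic`), each a strong
  kernel-preserving extension (Kirby 2013 §2, Bays–Kirby §3.3 and the proofs of Thm 5.9 and of
  Thm 6.9, QM2).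

## References

* M. Bays, J. Kirby, *Pseudo-exponential maps, variants, and quasiminimality*, Algebra & Number
  Theory 12 (2018) 493–549: §3.2, Def. 4.3, Thm 5.9, Notation 5.10, Thm 6.9 (QM2), §9.2.
* J. Kirby, *Finitely presented exponential fields*, Algebra & Number Theory 7 (2013): §2.
-/

noncomputable section

open Set

namespace Literature.NumberTheory.Transcendental

namespace BKModel

open GammaField Literature.ModelTheory.ExponentialFields Literature.FieldTheory.AlgClosed

variable {Ω : Type*} [Field Ω]

/-! ### Homomorphisms `(Ω, +) → (Ω, ·)` and the exponential-ring structures they define -/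

variable (Ω) in
/-- A homomorphism from the additive to the multiplicative structure of `Ω` — Mathlib's additive
characters `AddChar Ω Ω` (a total extension of a partial exponential map, Kirby 2013 §2; only its
values on the current domain matter). [cite: Kirby2013FPEF, §2] -/
abbrev EHom : Type _ := AddChar Ω Ω

namespace EHom

/-- The exponential-ring structure on `Ω` given by `E`. [folklore] -/
@[reducible] def inst (E : EHom Ω) : ExponentialRing Ω := ⟨E, E.map_zero_eq_one, E.map_add_eq_mul⟩

/-- `E a ≠ 0`. [folklore] -/
theorem ne_zero (E : EHom Ω) (a : Ω) : E a ≠ 0 := (E.val_isUnit a).ne_zero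

/-- `E (q • a)^(q.den) = (E a)^(q.num)` — rational multiples have values radical over `E a`
(`AddChar.map_nsmul_eq_pow`, `AddChar.map_zsmul_eq_zpow`). [folklore] -/
theorem map_rat_smul_pow_den [CharZero Ω] (E : EHom Ω) (q : ℚ) (a : Ω) :
    E (q • a) ^ q.den = E a ^ q.num := by
  rw [← E.map_nsmul_eq_pow, ← Nat.cast_smul_eq_nsmul ℚ, smul_smul, Rat.den_mul_eq_num,
    Int.cast_smul_eq_zsmul, E.map_zsmul_eq_zpow]

end EHom

/-! ### Predimension and strongness relative to `E` -/

variable [CharZero Ω]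

/-- `δ_E(Λ'/Λ)`: the predimension computed with the exponential map `E`. [cite: BaysKirby2018ANT, Def. 4.1] -/
def δ (E : EHom Ω) (Λ Λ' : Submodule ℚ Ω) : ℤ := @GammaField.predim Ω _ _ E.inst Λ Λ'

/-- **The predimension clause of `A ◁ B`** in the partial E-field `(B, E)` (Bays–Kirby 2018,
Def. 4.3, for the Γ-field with domain `B`): every finitely generated `X` with `A ≤ X ≤ B` has
`δ_E(X/A) ≥ 0`. Def. 4.3 also requires kernel preservation; that clause is carried separately by
`State.ker` and `Step.eqOn` below, so `StrongIn` alone is *not* the full relation `◁`.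
[cite: BaysKirby2018ANT, Def. 4.3 (predimension clause)] -/
def StrongIn (E : EHom Ω) (A B : Submodule ℚ Ω) : Prop :=
  ∀ ⦃X : Submodule ℚ Ω⦄, A ≤ X → X ≤ B → IsFG A X → 0 ≤ δ E A X

/-- The generators `Λ ∪ E Λ` of the Γ-field of `Λ` with respect to `E` only depend on `E|Λ`.
[folklore] -/
theorem gens_congr {E E' : EHom Ω} {Λ : Submodule ℚ Ω} (h : ∀ v ∈ Λ, E v = E' v) :
    @GammaField.gens Ω _ _ E.inst Λ = @GammaField.gens Ω _ _ E'.inst Λ := by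
  change (Λ : Set Ω) ∪ (⇑E) '' (Λ : Set Ω) = (Λ : Set Ω) ∪ (⇑E') '' (Λ : Set Ω)
  congr 1
  exact image_congr fun v hv => h v hv

/-- The predimension `δ_E(Λ'/Λ)` only depends on the values of `E` on `Λ` and `Λ'`. [folklore] -/
theorem δ_congr {E E' : EHom Ω} {Λ Λ' : Submodule ℚ Ω} (h : ∀ v ∈ Λ, E v = E' v)
    (h' : ∀ v ∈ Λ', E v = E' v) : δ E Λ Λ' = δ E' Λ Λ' := by
  simp only [δ, GammaField.predim, GammaField.td_def]
  rw [gens_congr h, gens_congr h']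

/-- `StrongIn` only depends on the values of `E` on `B`. [folklore] -/
theorem strongIn_congr {E E' : EHom Ω} {A B : Submodule ℚ Ω} (hAB : A ≤ B) (h : ∀ v ∈ B, E v = E' v)
    (hs : StrongIn E A B) : StrongIn E' A B := fun X hAX hXB hfg => by
  rw [← δ_congr (fun v hv => h v (hAB hv)) (fun v hv => h v (hXB hv))]
  exact hs hAX hXB hfg

/-- **Transitivity of strongness**: `A ◁ B` and `B ◁ C` give `A ◁ C` (Bays–Kirby 2018, Lemma 4.4;
submodularity of `δ`). [cite: BaysKirby2018ANT, Lemma 4.4] -/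
theorem StrongIn.trans {E : EHom Ω} {A B C : Submodule ℚ Ω} (hAB : StrongIn E A B)
    (hBC : StrongIn E B C) (hle : A ≤ B) (hBC' : B ≤ C) : StrongIn E A C := by
  letI := E.inst
  intro X hAX hXC hfgX
  -- `δ(X/A) = δ(X/X ⊓ B) + δ(X ⊓ B/A)`
  have h1 : A ≤ X ⊓ B := le_inf hAX hle
  have hadd := predim_add h1 (inf_le_left : X ⊓ B ≤ X) hfgX
  have hfgXB : IsFG (X ⊓ B) X := hfgX.of_le_left h1
  have hsub : predim B (X ⊔ B) ≤ predim (X ⊓ B) X := predim_sup_le X B hfgXB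
  have hB : 0 ≤ predim B (X ⊔ B) :=
    hBC le_sup_right (sup_le hXC hBC') (isFG_sup_right.2 ((isFG_iff_isFG_inf X B).2 hfgXB))
  have hA : 0 ≤ predim A (X ⊓ B) := hAB h1 inf_le_right (hfgX.mono inf_le_left)
  change 0 ≤ predim A X
  linarith

/-- `A ◁ A`. [folklore] -/
theorem strongIn_self (E : EHom Ω) (A : Submodule ℚ Ω) : StrongIn E A A := fun X hAX hXA _ => by
  letI := E.inst
  rw [le_antisymm hXA hAX]
  change 0 ≤ predim A A
  rw [predim_self]

/-- Restricting the top: `A ◁ C` gives `A ◁ B` for `B ≤ C`. [folklore] -/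
theorem StrongIn.mono_right {E : EHom Ω} {A B C : Submodule ℚ Ω} (h : StrongIn E A C) (hBC : B ≤ C) :
    StrongIn E A B := fun _ hAX hXB hfg => h hAX (hXB.trans hBC) hfg

/-- A radical of an element of `acl s` lies in `acl s`, in `zpow` form: if `a^(q.den) = y^(q.num)`
with `q ≠ 0` and `a ∈ acl s` then `y ∈ acl s`. [folklore] -/
theorem mem_acl_of_pow_den_eq {s : Set Ω} {a y : Ω} {q : ℚ} (hq : q ≠ 0)
    (h : a ^ q.den = y ^ q.num) (ha : a ∈ acl s) : y ∈ acl s := by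
  have hnum : q.num ≠ 0 := Rat.num_ne_zero.2 hq
  have hpow : y ^ q.num ∈ acl s := by
    rw [← h, ← zpow_natCast]; exact zpow_mem_acl ha _
  rcases Int.natAbs_eq q.num with hn | hn
  · rw [hn, zpow_natCast] at hpow
    exact mem_acl_of_pow_mem (Int.natAbs_ne_zero.2 hnum) hpow
  · rw [hn, zpow_neg, zpow_natCast] at hpow
    have := inv_mem_acl hpow
    rw [inv_inv] at this
    exact mem_acl_of_pow_mem (Int.natAbs_ne_zero.2 hnum) this

/-! ### The setting: a partial exponential field with standard kernel embedded in `Ω` -/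

section Setting

variable {K : Type*} [Field K] [CharZero K]

/-- `ι` as a `ℚ`-linear map. [folklore] -/
abbrev linOf (ι : K →+* Ω) : K →ₗ[ℚ] Ω := ι.toRatAlgHom.toLinearMap

/-- The base subspace `ι(D)`. [folklore] -/
def baseSub (ι : K →+* Ω) (D : Submodule ℚ K) : Submodule ℚ Ω := D.map (linOf ι)

/-- Membership in the base subspace. [folklore] -/
theorem mem_baseSub_iff {ι : K →+* Ω} {D : Submodule ℚ K} {v : Ω} :
    v ∈ baseSub ι D ↔ ∃ x ∈ D, ι x = v := by
  simp [baseSub, Submodule.mem_map]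

/-- The base subspace is the span of `ι(D)`. [folklore] -/
theorem span_image_eq_baseSub (ι : K →+* Ω) (D : Submodule ℚ K) :
    Submodule.span ℚ (ι '' (D : Set K)) = baseSub ι D := by
  have : (ι '' (D : Set K)) = linOf ι '' (D : Set K) := rfl
  rw [this, baseSub, ← Submodule.map_span, Submodule.span_eq]

variable (ι : K →+* Ω) (D : Submodule ℚ K) (θ : K → K) (τ : K)

/-- **A stage of the construction**: a `ℚ`-subspace `Λ ⊇ ι(D)`, finitely generated over it, with a
homomorphism `E : (Ω, +) → (Ω, ·)` extending `ι ∘ θ` on `ι(D)` whose kernel on `Λ` is exactly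
`ι(τ)ℤ` (a finitely generated, kernel-preserving partial-exponential-field extension of the base,
Bays–Kirby 2018 §3.2, §9.2). [cite: BaysKirby2018ANT, Def. 3.15 and §9.2] -/
structure State where
  /-- the domain of the partial exponential map -/
  Λ : Submodule ℚ Ω
  /-- a total homomorphic extension of the partial exponential map -/
  E : EHom Ω
  /-- the domain contains the base -/
  base_le : baseSub ι D ≤ Λ
  /-- `E` extends `θ` -/
  base_exp : ∀ x ∈ D, E (ι x) = ι (θ x)
  /-- the kernel on `Λ` is standard -/
  ker : ∀ v ∈ Λ, E v = 1 ↔ v ∈ AddSubgroup.zmultiples (ι τ)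
  /-- finite generation over the base -/
  fg : IsFG (baseSub ι D) Λ

variable {ι D θ τ}

/-- **Strong extension of stages**: `σ'` extends `σ` (same values on `σ.Λ`) and `σ.Λ ◁ σ'.Λ`.
[cite: BaysKirby2018ANT, Def. 4.3] -/
structure Step (σ σ' : State ι D θ τ) : Prop where
  /-- the domain grows -/
  le : σ.Λ ≤ σ'.Λ
  /-- the values on the old domain are kept -/
  eqOn : ∀ v ∈ σ.Λ, σ'.E v = σ.E v
  /-- the old domain is strong in the new one -/
  strong : StrongIn σ'.E σ.Λ σ'.Λ

/-- Reflexivity. [folklore] -/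
theorem Step.refl (σ : State ι D θ τ) : Step σ σ := ⟨le_rfl, fun _ _ => rfl, strongIn_self _ _⟩

/-- Transitivity. [cite: BaysKirby2018ANT, Lemma 4.4] -/
theorem Step.trans {σ σ' σ'' : State ι D θ τ} (h : Step σ σ') (h' : Step σ' σ'') : Step σ σ'' where
  le := h.le.trans h'.le
  eqOn v hv := (h'.eqOn v (h.le hv)).trans (h.eqOn v hv)
  strong := (strongIn_congr h.le (fun v hv => (h'.eqOn v hv).symm) h.strong).trans h'.strong h.le h'.le

/-- **Finite support**: the Γ-field of a stage is algebraic over `ι(K)` and finitely many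
elements. [folklore] -/
theorem State.exists_finite_support (σ : State ι D θ τ) :
    ∃ S : Set Ω, S.Finite ∧ @GammaField.gens Ω _ _ σ.E.inst σ.Λ ⊆ acl (S ∪ range ι) := by
  classical
  obtain ⟨s, -, hle⟩ := isFG_iff_exists_finset.1 σ.fg
  refine ⟨(s : Set Ω) ∪ σ.E '' (s : Set Ω), s.finite_toSet.union (s.finite_toSet.image _), ?_⟩
  set T : Set Ω := ((s : Set Ω) ∪ σ.E '' (s : Set Ω)) ∪ range ι with hT
  -- elements of the base and their exponentials
  have hbase : ∀ v ∈ baseSub ι D, v ∈ acl T ∧ σ.E v ∈ acl T := by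
    intro v hv
    obtain ⟨x, hx, rfl⟩ := mem_baseSub_iff.1 hv
    exact ⟨subset_acl _ (Or.inr ⟨x, rfl⟩), by rw [σ.base_exp x hx]; exact subset_acl _ (Or.inr ⟨θ x, rfl⟩)⟩
  -- elements of `span s` and their exponentials
  have hspan : ∀ w ∈ Submodule.span ℚ (s : Set Ω), w ∈ acl T ∧ σ.E w ∈ acl T := by
    intro w hw
    induction hw using Submodule.span_induction with
    | mem w hw => exact ⟨subset_acl _ (Or.inl (Or.inl hw)), subset_acl _ (Or.inl (Or.inr ⟨w, hw, rfl⟩))⟩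
    | zero => exact ⟨zero_mem_acl _, by rw [σ.E.map_zero_eq_one]; exact one_mem_acl _⟩
    | add w w' _ _ hw hw' =>
      exact ⟨add_mem_acl hw.1 hw'.1, by rw [σ.E.map_add_eq_mul]; exact mul_mem_acl hw.2 hw'.2⟩
    | smul q w _ hw =>
      refine ⟨smul_mem_acl q hw.1, mem_acl_of_pow_mem q.den_nz ?_⟩
      rw [σ.E.map_rat_smul_pow_den]
      exact zpow_mem_acl hw.2 _
  -- all of `Λ`
  have hΛ : ∀ v ∈ σ.Λ, v ∈ acl T ∧ σ.E v ∈ acl T := by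
    intro v hv
    obtain ⟨b, hb, w, hw, rfl⟩ := Submodule.mem_sup.1 (hle hv)
    exact ⟨add_mem_acl (hbase b hb).1 (hspan w hw).1,
      by rw [σ.E.map_add_eq_mul]; exact mul_mem_acl (hbase b hb).2 (hspan w hw).2⟩
  letI := σ.E.inst
  intro z hz
  rw [mem_gens_iff] at hz
  rcases hz with hz | ⟨v, hv, rfl⟩
  · exact (hΛ z hz).1
  · exact (hΛ v hv).2

/-! ### Two small tools -/

/-- The relative rank of a point outside the closure is one. [folklore] -/
theorem relRank_singleton_eq_one {C : Set Ω} {g : Ω} (hg : g ∉ acl C) :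
    (algMatroid Ω).relRank C {g} = 1 := by
  have h0 : (algMatroid Ω).relRank C ∅ = 0 :=
    (algMatroid Ω).relRank_eq_zero_of_subset_closure (empty_subset _)
  have := (algMatroid Ω).relRank_insert_eq_add_one (C := C) (X := ∅) (e := g) (by simp)
    (by rw [empty_union]; exact hg)
  rw [h0, zero_add] at this
  simpa using this

/-- A subspace between `Λ` and `Λ + ℚa` other than `Λ` contains an element `v + q a`, `q ≠ 0`,
`v ∈ Λ`. [folklore] -/
theorem exists_mem_of_not_le {Λ X : Submodule ℚ Ω} {a : Ω} (hX : X ≤ Λ ⊔ Submodule.span ℚ {a})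
    (hXΛ : ¬ X ≤ Λ) : ∃ v ∈ Λ, ∃ q : ℚ, q ≠ 0 ∧ v + q • a ∈ X := by
  obtain ⟨x, hxX, hxΛ⟩ := Set.not_subset.1 hXΛ
  obtain ⟨v, hv, w, hw, rfl⟩ := Submodule.mem_sup.1 (hX hxX)
  obtain ⟨q, rfl⟩ := Submodule.mem_span_singleton.1 hw
  refine ⟨v, hv, q, fun hq => hxΛ ?_, hxX⟩
  rw [hq, zero_smul, add_zero]; exact hv

/-! ### The kernel element and roots of unity at a stage -/

section Kernel

variable {D : Submodule ℚ K} {θ : K → K} {τ : K} (hK : IsStdKernelPartialExpField K D θ τ)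
include hK

/-- `ι τ` lies in the domain of every stage. [folklore] -/
theorem State.tau_mem (σ : State ι D θ τ) : ι τ ∈ σ.Λ :=
  σ.base_le (mem_baseSub_iff.2 ⟨τ, hK.mem, rfl⟩)

/-- `E (ι τ) = 1`. [folklore] -/
theorem State.apply_tau (σ : State ι D θ τ) : σ.E (ι τ) = 1 := by
  rw [σ.base_exp τ hK.mem, hK.map_tau, map_one]

omit [CharZero Ω] in
/-- `ι τ ≠ 0`. [folklore] -/
theorem tau_ne_zero : ι τ ≠ 0 := fun h => hK.tau_ne_zero (ι.injective (by rw [h, map_zero]))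

/-- `zmultiples (ι τ) ⊆ Λ`. [folklore] -/
theorem State.zmultiples_subset (σ : State ι D θ τ) {v : Ω} (hv : v ∈ AddSubgroup.zmultiples (ι τ)) :
    v ∈ σ.Λ := by
  obtain ⟨z, rfl⟩ := AddSubgroup.mem_zmultiples_iff.1 hv
  exact σ.Λ.toAddSubgroup.zsmul_mem (σ.tau_mem hK) z

/-- **`E (ι τ / m)` is a primitive `m`-th root of unity** at every stage (the kernel on the domain
is exactly `ι(τ)ℤ`; Bays–Kirby 2018 §9.1: "`θ(τ/m)` has order `m`").
[cite: BaysKirby2018ANT, §9.1 and Thm 9.1 (2)] -/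
theorem State.isPrimitiveRoot (σ : State ι D θ τ) {m : ℕ} (hm : 0 < m) :
    IsPrimitiveRoot (σ.E ((m : ℚ)⁻¹ • ι τ)) m := by
  have hmem : ∀ q : ℚ, q • ι τ ∈ σ.Λ := fun q => σ.Λ.smul_mem q (σ.tau_mem hK)
  refine IsPrimitiveRoot.mk_of_lt _ hm ?_ fun l hl hlm h => ?_
  · rw [← σ.E.map_nsmul_eq_pow, ← Nat.cast_smul_eq_nsmul ℚ, smul_smul,
      mul_inv_cancel₀ (Nat.cast_ne_zero.2 hm.ne'), one_smul]
    exact σ.apply_tau hK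
  · rw [← σ.E.map_nsmul_eq_pow, ← Nat.cast_smul_eq_nsmul ℚ, smul_smul, σ.ker _ (hmem _)] at h
    obtain ⟨z, hz⟩ := AddSubgroup.mem_zmultiples_iff.1 h
    have hz' : ((z : ℚ) - (l : ℚ) * (m : ℚ)⁻¹) • ι τ = 0 := by
      rw [sub_smul, ← hz, Int.cast_smul_eq_zsmul, sub_self]
    rcases smul_eq_zero.1 hz' with h0 | h0
    · rw [sub_eq_zero] at h0
      have : (z : ℚ) * m = l := by rw [h0, inv_mul_cancel_right₀ (Nat.cast_ne_zero.2 hm.ne')]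
      have hzl : z * m = l := by exact_mod_cast this
      have hz0 : 0 < z := by
        have : (0 : ℤ) < z * m := by rw [hzl]; exact_mod_cast hl
        exact pos_of_mul_pos_left this (Int.natCast_nonneg m)
      have : (m : ℤ) ≤ l := by
        calc (m : ℤ) = 1 * m := (one_mul _).symm
          _ ≤ z * m := mul_le_mul_of_nonneg_right hz0 (Int.natCast_nonneg m)
          _ = l := hzl
      omega
    · exact tau_ne_zero (ι := ι) hK h0

/-- **No new roots**: if a non-zero power of `b` is a value of `E` on the domain then so is `b`
(`E(Λ)` is divisible and contains all roots of unity; Bays–Kirby 2018, Lemma 3.18). Hence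
`b ∉ E(Λ)` makes the extension by a logarithm of `b` kernel-preserving.
[cite: BaysKirby2018ANT, Lemma 3.18] -/
theorem State.mem_image_of_zpow_mem [IsAlgClosed Ω] (σ : State ι D θ τ) {b : Ω} {n : ℤ}
    (hn : n ≠ 0) (h : b ^ n ∈ σ.E '' σ.Λ) : b ∈ σ.E '' σ.Λ := by
  -- reduce to a positive natural exponent
  have key : ∀ (m : ℕ), 0 < m → b ^ m ∈ σ.E '' σ.Λ → b ∈ σ.E '' σ.Λ := by
    intro m hm hbm
    obtain ⟨μ, hμ, hμb⟩ := hbm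
    haveI : NeZero m := ⟨hm.ne'⟩
    set c := σ.E ((m : ℚ)⁻¹ • μ) with hc
    have hcm : c ^ m = b ^ m := by
      rw [hc, ← σ.E.map_nsmul_eq_pow, ← Nat.cast_smul_eq_nsmul ℚ, smul_smul,
        mul_inv_cancel₀ (Nat.cast_ne_zero.2 hm.ne'), one_smul, hμb]
    have hc0 : c ≠ 0 := σ.E.ne_zero _
    have hroot : (b / c) ^ m = 1 := by rw [div_pow, ← hcm, div_self (pow_ne_zero _ hc0)]
    obtain ⟨k, -, hk⟩ := (σ.isPrimitiveRoot hK hm).eq_pow_of_pow_eq_one hroot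
    refine ⟨(m : ℚ)⁻¹ • μ + (k : ℚ) • ((m : ℚ)⁻¹ • ι τ), σ.Λ.add_mem (σ.Λ.smul_mem _ hμ)
      (σ.Λ.smul_mem _ (σ.Λ.smul_mem _ (σ.tau_mem hK))), ?_⟩
    rw [σ.E.map_add_eq_mul, ← hc, Nat.cast_smul_eq_nsmul ℚ, σ.E.map_nsmul_eq_pow, hk,
      mul_div_cancel₀ _ hc0]
  rcases Int.natAbs_eq n with hn' | hn'
  · rw [hn', zpow_natCast] at h
    exact key _ (Int.natAbs_pos.2 hn) h
  · rw [hn', zpow_neg, zpow_natCast] at h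
    obtain ⟨μ, hμ, hμb⟩ := h
    refine key _ (Int.natAbs_pos.2 hn) ⟨-μ, σ.Λ.neg_mem hμ, ?_⟩
    rw [σ.E.map_neg_eq_inv, hμb, inv_inv]

end Kernel

/-! ### Extending a stage by one generator -/

section Extend

variable {D : Submodule ℚ K} {θ : K → K} {τ : K} (hK : IsStdKernelPartialExpField K D θ τ)
include hK

/-- **Extending a stage by one generator** (Kirby 2013 §2; Bays–Kirby 2018 §3.3: an extension is
specified by the value of the new generator together with a division sequence). Given a stage
`σ`, `a ∉ σ.Λ`, a value `y ≠ 0` such that no `E v · y^q` (`v ∈ σ.Λ`, `q ∈ ℚ ∖ {0}`, `y^q` any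
rational power) is `1` (kernel preservation), and `a` or `y` transcendental over the Γ-field of
`σ` (strongness), there is a stage `σ'` with domain `σ.Λ + ℚa` strongly extending `σ` with
`E' a = y`, `E' (v + q a) = E v · ρ q` for rational powers `ρ` of `y`.
[cite: Kirby2013FPEF, §2] [cite: BaysKirby2018ANT, §3.3 and Thm 5.9 (proof)] -/
theorem State.exists_extend [IsAlgClosed Ω] (σ : State ι D θ τ) {a : Ω} (ha : a ∉ σ.Λ) {y : Ω}
    (hy : y ≠ 0)
    (hker : ∀ ρ : ℚ → Ω, ρ 1 = y → (∀ q q', ρ (q + q') = ρ q * ρ q') → (∀ q, ρ q ≠ 0) →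
      ∀ v ∈ σ.Λ, ∀ q : ℚ, σ.E v * ρ q = 1 → q = 0)
    (hgen : a ∉ acl (@GammaField.gens Ω _ _ σ.E.inst σ.Λ) ∨ y ∉ acl (@GammaField.gens Ω _ _ σ.E.inst σ.Λ)) :
    ∃ σ' : State ι D θ τ, Step σ σ' ∧ σ'.Λ = σ.Λ ⊔ Submodule.span ℚ {a} ∧ σ'.E a = y ∧
      ∃ ρ : ℚ → Ω, ρ 1 = y ∧ (∀ q q', ρ (q + q') = ρ q * ρ q') ∧ (∀ q, ρ q ≠ 0) ∧
        ∀ v ∈ σ.Λ, ∀ q : ℚ, σ'.E (v + q • a) = σ.E v * ρ q := by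
  classical
  obtain ⟨E', ρ, h1, hadd, hne, hE', hform⟩ := exists_hom_extend_single σ.E.map_add_eq_mul σ.Λ ha hy
  have hE'0 : E' 0 = 1 := by
    have := hform 0 σ.Λ.zero_mem 0
    rw [zero_smul, add_zero, σ.E.map_zero_eq_one, ratPow_zero hadd hne, mul_one] at this
    exact this
  let E₁ : EHom Ω := ⟨E', hE'0, hE'⟩
  have hE₁Λ : ∀ v ∈ σ.Λ, E₁ v = σ.E v := fun v hv => by
    have := hform v hv 0
    rw [zero_smul, add_zero, ratPow_zero hadd hne, mul_one] at this
    exact this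
  have hE₁a : E₁ a = y := by
    have := hform 0 σ.Λ.zero_mem 1
    rw [one_smul, zero_add, σ.E.map_zero_eq_one, one_mul, h1] at this
    exact this
  -- the new stage
  have hdec : ∀ v ∈ σ.Λ ⊔ Submodule.span ℚ {a}, ∃ w ∈ σ.Λ, ∃ q : ℚ, v = w + q • a := by
    intro v hv
    obtain ⟨w, hw, u, hu, rfl⟩ := Submodule.mem_sup.1 hv
    obtain ⟨q, rfl⟩ := Submodule.mem_span_singleton.1 hu
    exact ⟨w, hw, q, rfl⟩
  let σ' : State ι D θ τ :=
    { Λ := σ.Λ ⊔ Submodule.span ℚ {a}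
      E := E₁
      base_le := σ.base_le.trans le_sup_left
      base_exp := fun x hx => by
        rw [hE₁Λ _ (σ.base_le (mem_baseSub_iff.2 ⟨x, hx, rfl⟩))]; exact σ.base_exp x hx
      ker := fun v hv => by
        obtain ⟨w, hw, q, rfl⟩ := hdec v hv
        constructor
        · intro h
          change E' (w + q • a) = 1 at h
          rw [hform w hw q] at h
          have hq := hker ρ h1 hadd hne w hw q h
          rw [hq, ratPow_zero hadd hne, mul_one] at h
          rw [hq, zero_smul, add_zero]
          exact (σ.ker w hw).1 h
        · intro h
          have hmem : w + q • a ∈ σ.Λ := σ.zmultiples_subset hK h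
          change E₁ (w + q • a) = 1
          rw [hE₁Λ _ hmem]
          exact (σ.ker _ hmem).2 h
      fg := σ.fg.sup (isFG_span_of_finite _ (finite_singleton a)) }
  refine ⟨σ', ⟨le_sup_left, hE₁Λ, ?_⟩, rfl, hE₁a, ρ, h1, hadd, hne, fun v hv q => hform v hv q⟩
  -- strongness of the one-generator extension
  intro X hΛX hX hfg
  letI := E₁.inst
  change 0 ≤ predim σ.Λ X
  by_cases hXΛ : X ≤ σ.Λ
  · rw [le_antisymm hXΛ hΛX, predim_self]
  obtain ⟨v, hv, q, hq, hvq⟩ := exists_mem_of_not_le hX hXΛ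
  -- linear dimension at most one
  have hfg1 : IsFG σ.Λ (σ.Λ ⊔ Submodule.span ℚ {a}) :=
    isFG_sup_left.2 (isFG_span_of_finite _ (finite_singleton a))
  have hl : ldim σ.Λ X ≤ 1 :=
    (ldim_mono hfg1 hX).trans (by rw [ldim_sup_left]; exact ldim_span_singleton_le _ _)
  -- an element of `gens X` outside `acl (gens Λ)`
  have hgensΛ : gens σ.Λ = @GammaField.gens Ω _ _ σ.E.inst σ.Λ := gens_congr hE₁Λ
  have hex : ∃ g ∈ gens X, g ∉ acl (gens σ.Λ) := by
    rcases hgen with hg | hg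
    · refine ⟨v + q • a, mem_gens_of_mem hvq, fun hmem => hg ?_⟩
      rw [hgensΛ] at hmem
      have hvacl : v ∈ acl (@GammaField.gens Ω _ _ σ.E.inst σ.Λ) :=
        subset_acl _ (@GammaField.mem_gens_of_mem Ω _ _ σ.E.inst _ _ hv)
      have : a = q⁻¹ • ((v + q • a) - v) := by
        rw [add_sub_cancel_left, smul_smul, inv_mul_cancel₀ hq, one_smul]
      rw [this]
      exact smul_mem_acl _ (add_mem_acl hmem (neg_mem_acl hvacl) |> fun h => by rwa [← sub_eq_add_neg] at h)
    · refine ⟨E₁ (v + q • a), exp_mem_gens hvq, fun hmem => hg ?_⟩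
      rw [hgensΛ] at hmem
      change E' (v + q • a) ∈ _ at hmem
      rw [hform v hv q] at hmem
      have hEv : (σ.E v)⁻¹ ∈ acl (@GammaField.gens Ω _ _ σ.E.inst σ.Λ) :=
        inv_mem_acl (subset_acl _ (@GammaField.exp_mem_gens Ω _ _ σ.E.inst _ _ hv))
      have hρ : ρ q ∈ acl (@GammaField.gens Ω _ _ σ.E.inst σ.Λ) := by
        have := mul_mem_acl hEv hmem
        rwa [inv_mul_cancel_left₀ (σ.E.ne_zero v)] at this
      exact mem_acl_of_pow_den_eq hq (ratPow_pow_den h1 hadd hne q) hρ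
  obtain ⟨g, hgX, hgacl⟩ := hex
  -- transcendence degree at least one
  have htd : 1 ≤ td σ.Λ X := by
    rw [td_def, ← relRank_singleton_eq_one hgacl]
    exact (algMatroid Ω).relRank_mono_right _ (singleton_subset_iff.2 hgX)
  have hfin : td σ.Λ X ≠ ⊤ := td_ne_top hfg
  have htd' : 1 ≤ (td σ.Λ X).toNat := by
    have : ((1 : ℕ) : ℕ∞) ≤ td σ.Λ X := by exact_mod_cast htd
    rw [← ENat.coe_toNat hfin] at this
    exact_mod_cast this
  rw [predim_def]
  omega

end Extend

/-! ### The three elementary steps -/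

section Steps

variable {D : Submodule ℚ K} {θ : K → K} {τ : K} (hK : IsStdKernelPartialExpField K D θ τ)
include hK

omit hK in
/-- Fresh elements: over the Γ-field of a stage and finitely many further elements there is a
transcendental element, granted transcendentals over `ι(K)` and finitely many elements.
[folklore] -/
theorem State.exists_fresh (σ : State ι D θ τ)
    (fresh : ∀ S : Set Ω, S.Finite → ∃ w, w ∉ acl (S ∪ range ι)) {T : Set Ω} (hT : T.Finite) :
    ∃ w, w ∉ acl (@GammaField.gens Ω _ _ σ.E.inst σ.Λ ∪ T) := by
  obtain ⟨S, hS, hsub⟩ := σ.exists_finite_support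
  obtain ⟨w, hw⟩ := fresh (S ∪ T) (hS.union hT)
  refine ⟨w, fun h => hw (acl_subset_acl_of_subset ?_ h)⟩
  refine union_subset (hsub.trans (acl_mono ?_)) fun t ht => subset_acl _ (Or.inl (Or.inr ht))
  exact union_subset_union_left _ subset_union_left

/-- **Adjoining an exponential** (step (d)): any `ω` can be put into the domain, with a value
transcendental over the current Γ-field. [cite: BaysKirby2018ANT, Thm 5.9 (proof, fullness)] -/
theorem State.exists_step_exp [IsAlgClosed Ω] (σ : State ι D θ τ)
    (fresh : ∀ S : Set Ω, S.Finite → ∃ w, w ∉ acl (S ∪ range ι)) (ω : Ω) :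
    ∃ σ' : State ι D θ τ, Step σ σ' ∧ ω ∈ σ'.Λ := by
  by_cases hω : ω ∈ σ.Λ
  · exact ⟨σ, Step.refl σ, hω⟩
  obtain ⟨y, hy⟩ := σ.exists_fresh fresh (finite_empty)
  rw [union_empty] at hy
  have hy0 : y ≠ 0 := fun h => hy (h ▸ zero_mem_acl _)
  have hker : ∀ ρ : ℚ → Ω, ρ 1 = y → (∀ q q', ρ (q + q') = ρ q * ρ q') → (∀ q, ρ q ≠ 0) →
      ∀ v ∈ σ.Λ, ∀ q : ℚ, σ.E v * ρ q = 1 → q = 0 := by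
    intro ρ h1 hadd hne v hv q h
    by_contra hq
    have hρ : ρ q ∈ acl (@GammaField.gens Ω _ _ σ.E.inst σ.Λ) := by
      have hEv : (σ.E v)⁻¹ ∈ acl (@GammaField.gens Ω _ _ σ.E.inst σ.Λ) :=
        inv_mem_acl (subset_acl _ (@GammaField.exp_mem_gens Ω _ _ σ.E.inst _ _ hv))
      have : ρ q = (σ.E v)⁻¹ := (eq_inv_of_mul_eq_one_right h)
      rw [this]; exact hEv
    exact hy (mem_acl_of_pow_den_eq hq (ratPow_pow_den h1 hadd hne q) hρ)
  obtain ⟨σ', hstep, hΛ, -, -⟩ := σ.exists_extend hK hω hy0 hker (Or.inr hy)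
  exact ⟨σ', hstep, hΛ ▸ Submodule.mem_sup_right (Submodule.mem_span_singleton_self ω)⟩

/-- **Adjoining a logarithm** (step (c)): any non-zero `b` can be put into the image of the
domain, by a generator transcendental over the current Γ-field; the kernel is preserved because
`E(Λ)` is divisible and contains the roots of unity (`State.mem_image_of_zpow_mem`).
[cite: BaysKirby2018ANT, Thm 5.9 (proof, fullness) and Lemma 3.18] -/
theorem State.exists_step_log [IsAlgClosed Ω] (σ : State ι D θ τ)
    (fresh : ∀ S : Set Ω, S.Finite → ∃ w, w ∉ acl (S ∪ range ι)) {b : Ω} (hb : b ≠ 0) :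
    ∃ σ' : State ι D θ τ, Step σ σ' ∧ b ∈ σ'.E '' σ'.Λ := by
  by_cases hbΛ : b ∈ σ.E '' σ.Λ
  · exact ⟨σ, Step.refl σ, hbΛ⟩
  obtain ⟨a, ha⟩ := σ.exists_fresh fresh (finite_empty)
  rw [union_empty] at ha
  have haΛ : a ∉ σ.Λ := fun h => ha (subset_acl _ (@GammaField.mem_gens_of_mem Ω _ _ σ.E.inst _ _ h))
  have hker : ∀ ρ : ℚ → Ω, ρ 1 = b → (∀ q q', ρ (q + q') = ρ q * ρ q') → (∀ q, ρ q ≠ 0) →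
      ∀ v ∈ σ.Λ, ∀ q : ℚ, σ.E v * ρ q = 1 → q = 0 := by
    intro ρ h1 hadd hne v hv q h
    by_contra hq
    apply hbΛ
    -- `b^(q.num) = ρ(q)^(q.den) = E(-den • v)`
    have hρ : ρ q = σ.E (-v) := by rw [σ.E.map_neg_eq_inv]; exact eq_inv_of_mul_eq_one_right h
    have hpow : b ^ q.num ∈ σ.E '' σ.Λ := by
      refine ⟨q.den • (-v), σ.Λ.toAddSubgroup.nsmul_mem (σ.Λ.neg_mem hv) _, ?_⟩
      rw [σ.E.map_nsmul_eq_pow, ← hρ, ratPow_pow_den h1 hadd hne q]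
    exact σ.mem_image_of_zpow_mem hK (Rat.num_ne_zero.2 hq) hpow
  obtain ⟨σ', hstep, hΛ, hEa, -⟩ := σ.exists_extend hK haΛ hb hker (Or.inl ha)
  exact ⟨σ', hstep, ⟨a, hΛ ▸ Submodule.mem_sup_right (Submodule.mem_span_singleton_self a), hEa⟩⟩

/-- **Adjoining a generic point of `G¹`** (step (e); Bays–Kirby 2018, proof of Thm 6.9, QM2: "a
strong extension generated by `α` generic in `Gⁿ` over `F_base`"): a new generator `a` with
`(a, E a)` algebraically independent over the current Γ-field.
[cite: BaysKirby2018ANT, Thm 6.9 (proof of QM2)] -/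
theorem State.exists_step_generic [IsAlgClosed Ω] (σ : State ι D θ τ)
    (fresh : ∀ S : Set Ω, S.Finite → ∃ w, w ∉ acl (S ∪ range ι)) :
    ∃ (σ' : State ι D θ τ) (a : Ω), Step σ σ' ∧ σ'.Λ = σ.Λ ⊔ Submodule.span ℚ {a} ∧
      a ∉ acl (@GammaField.gens Ω _ _ σ.E.inst σ.Λ) ∧
      σ'.E a ∉ acl (@GammaField.gens Ω _ _ σ.E.inst σ.Λ ∪ {a}) := by
  obtain ⟨a, ha⟩ := σ.exists_fresh fresh (finite_empty)
  rw [union_empty] at ha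
  obtain ⟨y, hy⟩ := σ.exists_fresh fresh (finite_singleton a)
  have haΛ : a ∉ σ.Λ := fun h => ha (subset_acl _ (@GammaField.mem_gens_of_mem Ω _ _ σ.E.inst _ _ h))
  have hy' : y ∉ acl (@GammaField.gens Ω _ _ σ.E.inst σ.Λ) := fun h => hy (acl_mono subset_union_left h)
  have hy0 : y ≠ 0 := fun h => hy' (h ▸ zero_mem_acl _)
  have hker : ∀ ρ : ℚ → Ω, ρ 1 = y → (∀ q q', ρ (q + q') = ρ q * ρ q') → (∀ q, ρ q ≠ 0) →
      ∀ v ∈ σ.Λ, ∀ q : ℚ, σ.E v * ρ q = 1 → q = 0 := by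
    intro ρ h1 hadd hne v hv q h
    by_contra hq
    have hρ : ρ q ∈ acl (@GammaField.gens Ω _ _ σ.E.inst σ.Λ) := by
      have hEv : (σ.E v)⁻¹ ∈ acl (@GammaField.gens Ω _ _ σ.E.inst σ.Λ) :=
        inv_mem_acl (subset_acl _ (@GammaField.exp_mem_gens Ω _ _ σ.E.inst _ _ hv))
      have : ρ q = (σ.E v)⁻¹ := (eq_inv_of_mul_eq_one_right h)
      rw [this]; exact hEv
    exact hy' (mem_acl_of_pow_den_eq hq (ratPow_pow_den h1 hadd hne q) hρ)
  obtain ⟨σ', hstep, hΛ, hEa, -⟩ := σ.exists_extend hK haΛ hy0 hker (Or.inl ha)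
  exact ⟨σ', a, hstep, hΛ, ha, hEa ▸ hy⟩

end Steps

/-! ### The initial stage -/

section Init

variable {D : Submodule ℚ K} {θ : K → K} {τ : K} (hK : IsStdKernelPartialExpField K D θ τ)
include hK

/-- **The base as the initial stage** (Bays–Kirby 2018 §9.2: the finitely generated partial
exponential field with standard kernel `F_base = (K, D, θ, τ)`, embedded by `ι`): domain `ι(D)`,
exponential map a total homomorphic extension of `ι ∘ θ ∘ ι⁻¹` (through a `ℚ`-linear retraction
onto `ι(D)`), kernel `ι(τ)ℤ`. [cite: BaysKirby2018ANT, §9.2] -/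
theorem State.exists_init : ∃ σ : State ι D θ τ, σ.Λ = baseSub ι D := by
  classical
  set B := baseSub ι D with hB
  -- preimages of elements of the base
  have hpre : ∀ v : B, ∃ x ∈ D, ι x = v := fun v => mem_baseSub_iff.1 v.2
  choose pre hpreD hpre using hpre
  have hpre_eq : ∀ {x : K} (hx : x ∈ D), pre ⟨ι x, mem_baseSub_iff.2 ⟨x, hx, rfl⟩⟩ = x :=
    fun {x} hx => ι.injective (hpre _)
  -- the partial exponential map on the base and its multiplicativity
  let g : B → Ω := fun v => ι (θ (pre v))
  have hg : ∀ v w : B, g (v + w) = g v * g w := by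
    intro v w
    have hvw : pre (v + w) = pre v + pre w := ι.injective (by
      rw [map_add, hpre, hpre, hpre]; rfl)
    simp only [g, hvw, hK.map_add (hpreD v) (hpreD w), map_mul]
  -- a linear retraction onto the base
  obtain ⟨r, hr⟩ := LinearMap.exists_extend (LinearMap.id : B →ₗ[ℚ] B)
  have hr' : ∀ v : B, r v = v := fun v => LinearMap.congr_fun hr v
  have h0 : g (r 0) = 1 := by
    rw [map_zero]
    have : pre 0 = 0 := ι.injective (by rw [hpre, map_zero]; rfl)
    simp only [g, this, hK.map_zero, map_one]
  let E₀ : EHom Ω := ⟨fun v => g (r v), h0, fun a b => by simp only [map_add, hg]⟩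
  have hE₀ : ∀ {x : K} (hx : x ∈ D), E₀ (ι x) = ι (θ x) := by
    intro x hx
    change g (r (ι x)) = ι (θ x)
    have : r (ι x) = ⟨ι x, mem_baseSub_iff.2 ⟨x, hx, rfl⟩⟩ := hr' ⟨ι x, _⟩
    rw [this]
    simp only [g, hpre_eq hx]
  have hker : ∀ v ∈ B, E₀ v = 1 ↔ v ∈ AddSubgroup.zmultiples (ι τ) := by
    intro v hv
    obtain ⟨x, hx, rfl⟩ := mem_baseSub_iff.1 hv
    rw [hE₀ hx, ← map_one ι, ι.injective.eq_iff, hK.map_eq_one_iff hx,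
      AddSubgroup.mem_zmultiples_iff, AddSubgroup.mem_zmultiples_iff]
    constructor
    · rintro ⟨z, rfl⟩; exact ⟨z, by rw [← map_zsmul ι]⟩
    · rintro ⟨z, hz⟩
      refine ⟨z, ι.injective ?_⟩
      rw [map_zsmul ι, hz]
  let σ₀ : State ι D θ τ :=
    { Λ := B
      E := E₀
      base_le := le_rfl
      base_exp := fun x hx => hE₀ hx
      ker := hker
      fg := isFG_of_le le_rfl }
  exact ⟨σ₀, rfl⟩

end Init

end Setting

end BKModel

end Literature.NumberTheory.Transcendental
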